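import Summits.CriticalPhenomena.CardyFormulaZ2.Theorems.CardyMagicRigidityMarkovCascadeDefs
import Summits.CriticalPhenomena.CardyFormulaZ2.Theorems.CardyMagicRigidityNestingRigidityKernelTransferFamilies
import Literature.Probability.Percolation.LoopBoundaryRegularity
import Literature.Probability.Percolation.SiteLoopDensity
import Literature.Probability.Percolation.FKLoopNestingIntegrable
import HarnessLib

/-!
# Planar duality of the typed loop representation of bond percolation on `ℤ²`
# (helper toward line `markov-cascade-one-generation`, crux `NestingRigidity`, stmt-CriticalPhenomena-4835)

Route `CardyMagicRigidity` (sub-problem `CriticalPhenomena/CardyFormulaZ2`), crux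
`Summit.CriticalPhenomena.CardyFormulaZ2.Theses.CardyMagicRigidity.NestingRigidity`, line
`markov-cascade-one-generation` (vocabulary: `Theorems/CardyMagicRigidityMarkovCascadeDefs.lean`).
Registered stub `mem_bondLoopConfig_dualConfig_iff`: **planar duality on `ℤ²` at configuration level
is loop reversal + type swap + half-mesh shift**.  For a lattice configuration `ω` and its dual
configuration `dualConfig ω` (`Crossings.lean`: dual vertex `x` = the face with lower-left corner `x`,
i.e. the point `x + (½, ½)`), a loop `u` is a member of type `i` of `bondLoopConfig δ 0 (dualConfig ω)`
iff `u`, translated by `δ(1+i)/2` and read backwards, is a member of type `1 - i` of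
`bondLoopConfig δ 0 ω`.

Proof.  (1) *Corner duality*: the corner `(v, f)` of the medial lattice (dart from `cornerSource v f`
to `cornerTarget v f`, primal vertex `v` on the left) corresponds to the dual corner `(f, v - (1,1))`,
whose dart runs backwards through the dual edges: `cornerSource f (v - 1) = dualEdge (cornerTarget v f)`,
`cornerTarget f (v - 1) = dualEdge (cornerSource v f)` (`isCorner_dual`, from `dualEdge_cSrc`).  Hence
the turning rule dualises with its two disjuncts exchanged (`isMedialTurn_dualConfig`, and backwards
along `dualEdgeEquiv.symm`, `isMedialTurn_of_dualConfig`), and interface loops of `ω` read backwards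
through `dualEdge` are interface loops of `dualConfig ω` and conversely (`isInterfaceLoop_map_reverse`,
the re-indexing of `IsLatticeReflection.isInterfaceLoop`).  (2) *Geometry*:
`medialPoint δ (dualEdge e) = medialPoint δ e - δ(1+i)/2` on lattice edges, and the polyline of a
translated reversed vertex list is the translated, time-reversed polyline up to the base point
(`loopCurve_map_reverse_translate`, as `isoRectLoopCurve_map_reverse`; the base point is absorbed by
`unbasedLoop_loopCurve_rotate`).  (3) *Typing*: the shoelace area changes sign under reversal and not
under translation, and it never vanishes on interface loops (`IsInterfaceLoop.loopSignedArea_ne_zero`),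
so the type flips.
-/

noncomputable section

open MeasureTheory Set Filter
open scoped Topology BigOperators ENNReal Real

namespace Summit.CriticalPhenomena.CardyFormulaZ2.Cruxes.NestingRigidity.MarkovCascadeOneGeneration

open Literature.Probability.RandomPlanarGeometry Literature.Probability.Percolation
  Literature.Probability.LatticeModels
open Summit.CriticalPhenomena.CardyFormulaZ2.Theses.CardyMagicRigidity

/-! ### Corner duality on the medial lattice of `ℤ²` -/

/-- Opposite faces around a vertex: `cornerOff k + cornerOff (k + 2) = (1, 1)`. -/
theorem cornerOff_add_cornerOff_add_two (k : Fin 4) : cornerOff k + cornerOff (k + 2) = 1 := by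
  fin_cases k <;> decide

/-- The face opposite to `faceAt v k` across the vertex `v`, seen from the dual side: the dual face
about `v` has lower-left dual corner `v - (1, 1)`. -/
theorem faceAt_faceAt_add_two (v : Site 2) (k : Fin 4) : faceAt (faceAt v k) (k + 2) = v - 1 := by
  rw [faceAt, faceAt, sub_sub, cornerOff_add_cornerOff_add_two]

/-- **Corner duality.** The primal corner `(v, f)` is the dual corner `(f, v - (1, 1))` (dual vertex
`f`, dual face about `v`), traversed backwards through the dual edges: its source is the dual of the
primal target and its target the dual of the primal source. -/
theorem isCorner_dual {v f : Site 2} (h : IsCorner v f) :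
    IsCorner f (v - 1) ∧ cornerSource f (v - 1) = dualEdge (cornerTarget v f) ∧
      cornerTarget f (v - 1) = dualEdge (cornerSource v f) := by
  obtain ⟨k, rfl⟩ := exists_faceAt_of_isCorner h
  rw [← faceAt_faceAt_add_two v k, cornerSource_faceAt, cornerTarget_faceAt, cornerSource_faceAt,
    cornerTarget_faceAt]
  refine ⟨isCorner_faceAt _ _, ?_, ?_⟩
  · have h1 := dualEdge_cSrc v (k + 1)
    simp only [cSrc, cFace, fin4_add_one_add_three] at h1
    have hb : faceAt v k + cornerUnit (k + 2) = faceAt v (k + 1) := by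
      rw [faceAt, faceAt, show cornerUnit (k + 2) = cornerOff k - cornerOff (k + 1) by
        fin_cases k <;> decide]
      abel
    rw [hb, h1]
    exact Sym2.eq_swap
  · have h1 := dualEdge_cSrc v k
    simp only [cSrc, cFace] at h1
    have hc : faceAt v k + cornerUnit (k + 2 + 1) = faceAt v (k + 3) := by
      rw [add_assoc, show (2 : Fin 4) + 1 = 3 by decide, faceAt, faceAt,
        show cornerUnit (k + 3) = cornerOff k - cornerOff (k + 3) by fin_cases k <;> decide]
      abel
    rw [hc, h1]

/-- Corner duality read backwards: the dual corner `(v, f)` comes from the primal corner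
`(f + (1, 1), v)`, whose source and target are the `dualEdge`-preimages of the target and source. -/
theorem isCorner_undual {v f : Site 2} (h : IsCorner v f) :
    IsCorner (f + 1) v ∧ cornerSource (f + 1) v = dualEdgeEquiv.symm (cornerTarget v f) ∧
      cornerTarget (f + 1) v = dualEdgeEquiv.symm (cornerSource v f) := by
  have h' : IsCorner (f + 1) v := fun i ↦ by
    rcases h i with hi | hi
    · right; simp only [Pi.add_apply, Pi.one_apply]; omega
    · left; simp only [Pi.add_apply, Pi.one_apply]; omega
  obtain ⟨-, hs, ht⟩ := isCorner_dual h'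
  rw [add_sub_cancel_right] at hs ht
  refine ⟨h', ?_, ?_⟩
  · rw [Equiv.eq_symm_apply, dualEdgeEquiv_apply]
    exact ht.symm
  · rw [Equiv.eq_symm_apply, dualEdgeEquiv_apply]
    exact hs.symm

/-- **The turning rule dualises**: a medial turn of `ω` read backwards through `dualEdge` is a
medial turn of `dualConfig ω` (the primal vertex becomes the dual face, the face the dual vertex,
and the two disjuncts of `IsMedialTurn` are exchanged). No hypothesis on `ω`. -/
theorem isMedialTurn_dualConfig {ω : BondConfig (Site 2)} {e₀ e₁ e₂ : MedialVertex}
    (h : IsMedialTurn ω e₀ e₁ e₂) :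
    IsMedialTurn (dualConfig ω) (dualEdge e₂) (dualEdge e₁) (dualEdge e₀) := by
  obtain ⟨v₁, f₁, v₂, f₂, hc₁, hs₁, ht₁, hc₂, hs₂, ht₂, hdisj⟩ := h
  obtain ⟨hc₁', hs₁', ht₁'⟩ := isCorner_dual hc₁
  obtain ⟨hc₂', hs₂', ht₂'⟩ := isCorner_dual hc₂
  refine ⟨f₂, v₂ - 1, f₁, v₁ - 1, hc₂', by rw [hs₂', ht₂], by rw [ht₂', hs₂], hc₁',
    by rw [hs₁', ht₁], by rw [ht₁', hs₁], ?_⟩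
  rcases hdisj with ⟨hv, hd⟩ | ⟨hf, he⟩
  · exact Or.inr ⟨by rw [hv], hd⟩
  · refine Or.inl ⟨hf.symm, ?_⟩
    have he₁E : e₁ ∈ (zdGraph 2).edgeSet := ht₁ ▸ cornerTarget_mem_edgeSet hc₁
    rw [mem_dualConfig_iff]
    refine ⟨dualEdge_mem_edgeSet_holds (dualEdge_mem_edgeSet_holds he₁E), fun e' he' heq ↦ ?_⟩
    have hee : e' = dualEdge e₁ := dualEdge_bijective.1 heq
    exact (mem_dualConfig_iff.1 he').2 e₁ he hee.symm

/-- **The turning rule undualises**: a medial turn of `dualConfig ω` read backwards through the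
inverse edge bijection `dualEdgeEquiv.symm` is a medial turn of `ω`. No hypothesis on `ω`. -/
theorem isMedialTurn_of_dualConfig {ω : BondConfig (Site 2)} {e₀ e₁ e₂ : MedialVertex}
    (h : IsMedialTurn (dualConfig ω) e₀ e₁ e₂) :
    IsMedialTurn ω (dualEdgeEquiv.symm e₂) (dualEdgeEquiv.symm e₁) (dualEdgeEquiv.symm e₀) := by
  obtain ⟨v₁, f₁, v₂, f₂, hc₁, hs₁, ht₁, hc₂, hs₂, ht₂, hdisj⟩ := h
  obtain ⟨hc₁', hs₁', ht₁'⟩ := isCorner_undual hc₁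
  obtain ⟨hc₂', hs₂', ht₂'⟩ := isCorner_undual hc₂
  refine ⟨f₂ + 1, v₂, f₁ + 1, v₁, hc₂', by rw [hs₂', ht₂], by rw [ht₂', hs₂], hc₁',
    by rw [hs₁', ht₁], by rw [ht₁', hs₁], ?_⟩
  rcases hdisj with ⟨hv, hd⟩ | ⟨hf, he⟩
  · refine Or.inr ⟨hv.symm, ?_⟩
    have he₁E : e₁ ∈ (zdGraph 2).edgeSet := hs₂ ▸ cornerSource_mem_edgeSet hc₂
    have hd' := (mem_dualConfig_iff.1 hd).2
    have him : ∃ e ∈ ω, dualEdge e = e₁ := by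
      by_contra hc
      push Not at hc
      exact hd' e₁ (mem_dualConfig_iff.2 ⟨he₁E, hc⟩) rfl
    obtain ⟨e, heω, rfl⟩ := him
    rw [← dualEdgeEquiv_apply, Equiv.symm_apply_apply]
    exact heω
  · refine Or.inl ⟨by rw [hf], ?_⟩
    rw [← dualEdgeEquiv_apply, Equiv.apply_symm_apply]
    exact he

/-! ### Transport of interface loops -/

/-- **Transport of interface loops along an orientation-reversing edge map** (the re-indexing of
`IsLatticeReflection.isInterfaceLoop`): if `φ` is injective and sends every medial turn of `ω` to a
medial turn of `ω'` read backwards, then `(γ.map φ).reverse` is an interface loop of `ω'` for every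
interface loop `γ` of `ω`. -/
theorem isInterfaceLoop_map_reverse {ω ω' : BondConfig (Site 2)} {φ : MedialVertex → MedialVertex}
    (hφ : Function.Injective φ)
    (hturn : ∀ {e₀ e₁ e₂ : MedialVertex}, IsMedialTurn ω e₀ e₁ e₂ → IsMedialTurn ω' (φ e₂) (φ e₁) (φ e₀))
    {γ : List MedialVertex} (h : IsInterfaceLoop ω γ) : IsInterfaceLoop ω' ((γ.map φ).reverse) := by
  -- adapted from `IsLatticeReflection.isInterfaceLoop` (LoopRotationInvarianceAssembly)
  set γ' := (γ.map φ).reverse with hγ'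
  have hn : γ'.length = γ.length := by simp [hγ']
  have hn0 : 0 < γ.length := h.length_pos
  have hget : ∀ (k : ℕ) (hk : k < γ'.length), γ'[k] = φ (γ[γ.length - 1 - k]'(by omega)) := by
    intro k hk
    simp only [hγ', List.getElem_reverse, List.getElem_map, List.length_map]
  refine ⟨by simpa [hγ'] using h.ne_nil, ?_, ?_⟩
  · rw [List.nodup_iff_injective_get]
    have hinj := List.nodup_iff_injective_get.1 h.nodup
    intro a b hab
    have ha : (a : ℕ) < γ.length := by have := a.2; simp [hγ'] at this; omega
    have hb : (b : ℕ) < γ.length := by have := b.2; simp [hγ'] at this; omega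
    simp only [List.get_eq_getElem, List.getElem_zip, List.getElem_rotate, hn, Prod.mk.injEq,
      hget] at hab
    obtain ⟨h1, h2⟩ := hab
    have h1' := hφ h1
    have h2' := hφ h2
    set p : ℕ → ℕ := fun i ↦ γ.length - 1 - (i + 1) % γ.length with hp
    have hpa : p a < γ.length := by simp only [hp]; omega
    have hpb : p b < γ.length := by simp only [hp]; omega
    have hlenz : (γ.zip (γ.rotate 1)).length = γ.length := by simp
    have key : (γ.zip (γ.rotate 1)).get ⟨p a, by omega⟩ =
        (γ.zip (γ.rotate 1)).get ⟨p b, by omega⟩ := by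
      simp only [List.get_eq_getElem, List.getElem_zip, List.getElem_rotate, Prod.mk.injEq, hp,
        IsLatticeReflection.rev_succ_mod ha, IsLatticeReflection.rev_succ_mod hb]
      exact ⟨h2', h1'⟩
    have hpab : p a = p b := by simpa using congrArg Fin.val (hinj key)
    apply Fin.ext
    refine IsLatticeReflection.mod_succ_inj (n := γ.length) ha hb ?_
    simp only [hp] at hpab
    have := Nat.mod_lt (a + 1) hn0
    have := Nat.mod_lt (b + 1) hn0
    omega
  · intro i hi
    rw [hn] at hi
    have hcn : γ.length - 1 - (i + 2) % γ.length < γ.length := by omega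
    have hturn' := hturn (h.turn _ hcn)
    have e1 : (γ.length - 1 - (i + 2) % γ.length + 1) % γ.length =
        γ.length - 1 - (i + 1) % γ.length := by
      have : (i + 2) % γ.length = ((i + 1) % γ.length + 1) % γ.length := by rw [Nat.mod_add_mod]
      rw [this]
      exact IsLatticeReflection.rev_succ_mod (Nat.mod_lt _ hn0)
    have e2 : (γ.length - 1 - (i + 2) % γ.length + 2) % γ.length = γ.length - 1 - i := by
      rw [show γ.length - 1 - (i + 2) % γ.length + 2 = (γ.length - 1 - (i + 2) % γ.length + 1) + 1
        by ring, ← Nat.mod_add_mod, e1]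
      exact IsLatticeReflection.rev_succ_mod hi
    rw [getElem_congr_idx e2, getElem_congr_idx e1] at hturn'
    simp only [hget, hn]
    exact hturn'

/-- **Duality of interface loops**: an interface loop of `ω` read backwards through `dualEdge` is
an interface loop of the dual configuration. -/
theorem isInterfaceLoop_dualConfig {ω : BondConfig (Site 2)} {γ : List MedialVertex}
    (h : IsInterfaceLoop ω γ) : IsInterfaceLoop (dualConfig ω) ((γ.map dualEdge).reverse) :=
  isInterfaceLoop_map_reverse dualEdge_bijective.1 (fun ht ↦ isMedialTurn_dualConfig ht) h

/-- **Duality of interface loops, converse**: an interface loop of `dualConfig ω` read backwards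
through `dualEdgeEquiv.symm` is an interface loop of `ω`. -/
theorem isInterfaceLoop_of_dualConfig {ω : BondConfig (Site 2)} {γ : List MedialVertex}
    (h : IsInterfaceLoop (dualConfig ω) γ) :
    IsInterfaceLoop ω ((γ.map dualEdgeEquiv.symm).reverse) :=
  isInterfaceLoop_map_reverse dualEdgeEquiv.symm.injective (fun ht ↦ isMedialTurn_of_dualConfig ht) h

/-- Entries of an interface loop are lattice edges. -/
theorem mem_edgeSet_of_mem_interfaceLoop {ω : BondConfig (Site 2)} {γ : List MedialVertex}
    (h : IsInterfaceLoop ω γ) {e : MedialVertex} (he : e ∈ γ) : e ∈ (zdGraph 2).edgeSet := by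
  obtain ⟨i, hi, rfl⟩ := List.getElem_of_mem he
  exact h.getElem_mem_edgeSet cornerEdge_mem_edgeSet_holds i hi

/-! ### Geometry: dual edges sit half a mesh below-left; reversed translated polylines -/

/-- **The midpoint of the dual edge** (in the lower-left-corner indexing of dual vertices) is the
midpoint of the edge shifted by `-δ(1+i)/2`. -/
theorem medialPoint_dualEdge {e : MedialVertex} (he : e ∈ (zdGraph 2).edgeSet) (δ : ℝ) :
    medialPoint δ (dualEdge e) = medialPoint δ e + -(δ * (1 + Complex.I) / 2) := by
  obtain ⟨u, i, rfl⟩ := mem_edgeSet_zdGraph_iff.1 he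
  fin_cases i
  · rw [Fin.zero_eta, dualEdge_horizontal, medialPoint_mk, medialPoint_mk]
    apply Complex.ext <;> simp <;> ring
  · rw [Fin.mk_one, dualEdge_vertical, medialPoint_mk, medialPoint_mk]
    apply Complex.ext <;> simp <;> ring

/-- The midpoint of the `dualEdge`-preimage of a lattice edge is the midpoint shifted by
`+δ(1+i)/2`. -/
theorem medialPoint_dualEdgeEquiv_symm {e : MedialVertex} (he : e ∈ (zdGraph 2).edgeSet) (δ : ℝ) :
    medialPoint δ (dualEdgeEquiv.symm e) = medialPoint δ e + δ * (1 + Complex.I) / 2 := by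
  have he' : dualEdgeEquiv.symm e ∈ (zdGraph 2).edgeSet := by
    rw [← dualEdge_mem_edgeSet_iff, ← dualEdgeEquiv_apply, Equiv.apply_symm_apply]
    exact he
  have h := medialPoint_dualEdge he' δ
  rw [← dualEdgeEquiv_apply, Equiv.apply_symm_apply] at h
  rw [h]
  ring

/-- **The loop drawn by a reversed list of shifted edges** is the shifted, time-reversed loop of a
rotation of the list (the base point moves to the last dart): if `φ` shifts the midpoints of the
entries of `μ` by `c`, then `loopCurve δ 0 ((μ.map φ).reverse)` is the translate by `c` of
`loopCurve δ 0 (μ.rotate (μ.length - 1))`, reversed. -/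
theorem loopCurve_map_reverse_translate {φ : MedialVertex → MedialVertex} {c : ℂ} {δ : ℝ}
    {μ : List MedialVertex} (hμ : μ ≠ []) (hφ : ∀ e ∈ μ, medialPoint δ (φ e) = medialPoint δ e + c) :
    loopCurve δ 0 ((μ.map φ).reverse) =
      ((loopCurve δ 0 (μ.rotate (μ.length - 1))).map
        ⟨fun w ↦ 1 * w + c, continuous_translate c⟩).reverse := by
  -- adapted from `isoRectLoopCurve_map_reverse` (LoopRotationInvarianceAssembly)
  have hl : ((μ.map φ).reverse ++ ((μ.map φ).reverse).take 1).map (medialPoint δ) =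
      ((μ.reverse ++ μ.reverse.take 1).map (medialPoint δ)).map (fun w ↦ 1 * w + c) := by
    rw [List.map_map, ← List.map_reverse, ← List.map_take, ← List.map_append, List.map_map]
    refine List.map_congr_left fun e he ↦ ?_
    have he' : e ∈ μ := by
      rcases List.mem_append.1 he with h | h
      · exact List.mem_reverse.1 h
      · exact List.mem_reverse.1 (List.take_subset 1 _ h)
    simp only [Function.comp_apply, one_mul, hφ e he']
  obtain ⟨init, last, rfl⟩ : ∃ init last, μ = init ++ [last] :=
    ⟨μ.dropLast, μ.getLast hμ, (List.dropLast_append_getLast hμ).symm⟩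
  rw [show (init ++ [last]).length - 1 = init.length by simp, List.rotate_append_length_eq,
    loopCurve_zero, loopCurve_zero, hl]
  have hQ' : (init ++ [last]).reverse ++ ((init ++ [last]).reverse).take 1 =
      ([last] ++ init ++ ([last] ++ init).take 1).reverse := by simp
  rw [hQ', List.map_reverse]
  set Q := ([last] ++ init ++ ([last] ++ init).take 1).map (medialPoint δ) with hQ
  rw [CurveClass.reverse_map, CurveClass.reverse_mk, CurveClass.map_mk]
  have hrev : CurveClass.mk (E := ℂ) ⟨polyline Q.reverse⟩ =
      CurveClass.mk (Curve.reverse ⟨polyline Q⟩) :=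
    CurveClass.mk_eq_mk.2 (reparamDist_polyline_reverse Q)
  have hmap : (⟨polyline (Q.reverse.map fun w ↦ 1 * w + c)⟩ : Curve ℂ) =
      (⟨polyline Q.reverse⟩ : Curve ℂ).map ⟨fun w ↦ 1 * w + c, continuous_translate c⟩ := by
    ext t
    change polyline (Q.reverse.map fun w ↦ 1 * w + c) t = 1 * polyline Q.reverse t + c
    have hne : Q.reverse ≠ [] := by simp [hQ]
    obtain ⟨a, l, hal⟩ := List.exists_cons_of_ne_nil hne
    rw [hal, List.map_cons]
    exact (apply_polylineFrom (fun w : ℂ ↦ 1 * w + c) (fun x y r ↦ by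
      simp only [AffineMap.lineMap_apply_module, Complex.real_smul]; push_cast; ring) a l t).symm
  rw [hmap, ← CurveClass.map_mk, hrev, CurveClass.map_mk]

/-- **The unbased loop of a reversed list of shifted edges** is the translated, reversed unbased
loop (the change of base point is invisible for unbased loops, `unbasedLoop_loopCurve_rotate`). -/
theorem unbasedLoop_loopCurve_map_reverse_translate {φ : MedialVertex → MedialVertex} {c : ℂ}
    {δ : ℝ} {γ : List MedialVertex} (hγ : γ ≠ [])
    (hφ : ∀ e ∈ γ, medialPoint δ (φ e) = medialPoint δ e + c)
    (h₁ : (loopCurve δ 0 ((γ.map φ).reverse)).IsLoop) (h₂ : (loopCurve δ 0 γ).IsLoop) :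
    UnbasedLoop.mk (BasedLoop.mk (loopCurve δ 0 ((γ.map φ).reverse)) h₁) =
      ((UnbasedLoop.mk (BasedLoop.mk (loopCurve δ 0 γ) h₂)).map
        ⟨fun w ↦ 1 * w + c, continuous_translate c⟩ (isometry_translate c)).reverse := by
  rw [← unbasedLoop_loopCurve_rotate δ 0 hγ (γ.length - 1), UnbasedLoop.map_mk,
    UnbasedLoop.reverse_mk]
  congr 1
  exact Subtype.ext (loopCurve_map_reverse_translate hγ hφ)

/-- Translating by `c` and then by `-c` is the identity on unbased loops. -/
theorem map_translate_map_translate_neg (u : UnbasedLoop ℂ) (c : ℂ) :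
    (u.map ⟨fun w ↦ 1 * w + c, continuous_translate c⟩ (isometry_translate c)).map
      ⟨fun w ↦ 1 * w + -c, continuous_translate (-c)⟩ (isometry_translate (-c)) = u := by
  obtain ⟨ℓ, rfl⟩ := UnbasedLoop.mk_surjective u
  rw [UnbasedLoop.map_mk, UnbasedLoop.map_mk, BasedLoop.map_map]
  have hid : (⟨fun w ↦ 1 * w + -c, continuous_translate (-c)⟩ : C(ℂ, ℂ)).comp
      ⟨fun w ↦ 1 * w + c, continuous_translate c⟩ = ContinuousMap.id ℂ := by
    ext w
    simp
  rw [hid, BasedLoop.map_id]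

/-! ### Typing: reversal flips the shoelace area, translation does not -/

/-- The shoelace area of a reversed list of shifted edges is the opposite of the shoelace area. -/
theorem loopSignedArea_map_reverse_translate {φ : MedialVertex → MedialVertex} {c : ℂ}
    {γ : List MedialVertex} (hφ : ∀ e ∈ γ, medialPoint 1 (φ e) = medialPoint 1 e + c) :
    loopSignedArea ((γ.map φ).reverse) = -loopSignedArea γ := by
  rw [loopSignedArea, loopSignedArea, List.map_reverse, shoelace_reverse, List.map_map]
  have h : γ.map (medialPoint 1 ∘ φ) = (γ.map (medialPoint 1)).map (c + ·) := by
    rw [List.map_map]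
    refine List.map_congr_left fun e he ↦ ?_
    simp only [Function.comp_apply, hφ e he, add_comm]
  rw [h, shoelace_map_const_add]

/-- Type flip: if `loopSignedArea γ ≠ 0` and `γ'` has the opposite area, then `γ'` has type `i` iff
`γ` has type `1 - i`. -/
theorem loopType_eq_iff_of_neg {γ γ' : List MedialVertex} (hne : loopSignedArea γ ≠ 0)
    (hneg : loopSignedArea γ' = -loopSignedArea γ) (i : Fin 2) :
    loopType γ' = i ↔ loopType γ = 1 - i := by
  rcases lt_or_gt_of_ne hne with hlt | hgt
  · have h1 : loopType γ' = 1 := by rw [loopType, if_pos (by rw [hneg]; linarith)]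
    have h2 : loopType γ = 0 := by rw [loopType, if_neg (not_lt.2 hlt.le)]
    rw [h1, h2]
    fin_cases i <;> decide
  · have h1 : loopType γ' = 0 := by rw [loopType, if_neg (by rw [hneg]; linarith)]
    have h2 : loopType γ = 1 := by rw [loopType, if_pos hgt]
    rw [h1, h2]
    fin_cases i <;> decide

/-! ### The registered stub -/

/-- **Planar duality of the typed loop representation of `ℤ²` = reversal + type swap + half-mesh
shift.** For a lattice configuration `ω`, a loop `u` is a member of type `i` of the loop
representation of the dual configuration `dualConfig ω` (drawn by `loopCurve δ 0` through the
midpoints of the dual edges in lower-left-corner coordinates) iff `u` translated by `δ(1+i)/2` and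
read backwards is a member of type `1 - i` of the loop representation of `ω`: the interface loops of
`dualConfig ω` are exactly the interface loops of `ω` read backwards through `dualEdge`
(`isInterfaceLoop_dualConfig`, `isInterfaceLoop_of_dualConfig`), drawn half a mesh below-left
(`medialPoint_dualEdge`) and with the opposite orientation type (`loopSignedArea_map_reverse_translate`,
`IsInterfaceLoop.loopSignedArea_ne_zero`). (The hypothesis `ω ⊆ E(ℤ²)` is not used.) -/
theorem mem_bondLoopConfig_dualConfig_iff : ∀ (δ : ℝ) (ω : BondConfig (Site 2)), ω ⊆ (zdGraph 2).edgeSet → ∀ (i : Fin 2) (u : UnbasedLoop ℂ), u ∈ (bondLoopConfig δ 0 (dualConfig ω)).F i ↔ (u.map ⟨fun w ↦ 1 * w + δ * (1 + Complex.I) / 2, continuous_translate (δ * (1 + Complex.I) / 2)⟩ (isometry_translate (δ * (1 + Complex.I) / 2))).reverse ∈ (bondLoopConfig δ 0 ω).F (1 - i) := by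
  intro δ ω _ i u
  rw [mem_bondLoopConfig_iff, mem_bondLoopConfig_iff]
  constructor
  · rintro ⟨γ', h', hti, rfl⟩
    have h : IsInterfaceLoop ω ((γ'.map dualEdgeEquiv.symm).reverse) := isInterfaceLoop_of_dualConfig h'
    have hE : ∀ e ∈ γ', e ∈ (zdGraph 2).edgeSet := fun e he ↦ mem_edgeSet_of_mem_interfaceLoop h' he
    refine ⟨_, h, ?_, ?_⟩
    · refine (loopType_eq_iff_of_neg h'.loopSignedArea_ne_zero ?_ (1 - i)).2
        (by rw [sub_sub_cancel]; exact hti)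
      exact loopSignedArea_map_reverse_translate fun e he ↦ medialPoint_dualEdgeEquiv_symm (hE e he) 1
    · exact (unbasedLoop_loopCurve_map_reverse_translate h'.ne_nil
        (fun e he ↦ medialPoint_dualEdgeEquiv_symm (hE e he) δ) _ _).symm
  · rintro ⟨γ, h, hti, hu⟩
    have h' : IsInterfaceLoop (dualConfig ω) ((γ.map dualEdge).reverse) := isInterfaceLoop_dualConfig h
    have hE : ∀ e ∈ γ, e ∈ (zdGraph 2).edgeSet := fun e he ↦ mem_edgeSet_of_mem_interfaceLoop h he
    refine ⟨_, h', ?_, ?_⟩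
    · exact (loopType_eq_iff_of_neg h.loopSignedArea_ne_zero
        (loopSignedArea_map_reverse_translate fun e he ↦ medialPoint_dualEdge (hE e he) 1) i).2 hti
    · rw [unbasedLoop_loopCurve_map_reverse_translate h.ne_nil
        (fun e he ↦ medialPoint_dualEdge (hE e he) δ) (isLoop_loopCurve δ 0 h'.ne_nil)
        (isLoop_loopCurve δ 0 h.ne_nil), ← hu, UnbasedLoop.reverse_map, UnbasedLoop.reverse_reverse,
        map_translate_map_translate_neg]

end Summit.CriticalPhenomena.CardyFormulaZ2.Cruxes.NestingRigidity.MarkovCascadeOneGeneration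

end
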